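import Literature.NumberTheory.EllipticCurves.FormalGroupChartLimitLogProofs
import Mathlib.Analysis.SpecificLimits.Basic
import Mathlib.Topology.Algebra.Valued.NormedValued
import HarnessLib

/-!
# The limit logarithm on the kernel of reduction over a complete valued field, II: sums and
# kernel, the characterisation, Galois equivariance and norm-to-trace, complete normed fields

`Proofs` file (theorems only, no definitions, no named facts) in topic
`NumberTheory/EllipticCurves`; continuation of `FormalGroupChartLimitLogProofs` (setting and
notation there: valued field `(K, w)`, `w`-integral `V`, `E₁ = kernel w V`, `z = Affine.Point.zCoord`,
a natural number `p` with `0 < |p| < 1`, the level `E⁽ᵖ⁾ = level w V |p|`, and a function `ℓ`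
with the defining approximation property (SPEC) `∀ Q ∈ E⁽ᵖ⁾, ∀ r, |ℓ(Q) − z(pʳ·Q)/pʳ| ≤ |p|^{r+1}`,
whose existence is `exists_limitLog` there / `exists_limitLog_of_completeSpace` here).  Contents,
for ANY `ℓ` with (SPEC):

* `limitLog_zero`, `limitLog_neg`, `limitLog_sub`, `limitLog_sum`, `limitLog_nsmul` — `ℓ` is a
  homomorphism on `E⁽ᵖ⁾`; `eq_zero_of_limitLog_eq_zero` — no kernel strictly inside the level;
* `spec_of_additive_of_val_sub_zCoord_le` — **characterisation**: every function ADDITIVE on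
  `E⁽ᵖ⁾` with `|ℓ′(Q) − z(Q)| ≤ |z(Q)|²/|p|` satisfies (SPEC), hence equals `ℓ` on `E⁽ᵖ⁾`
  (`limitLog_unique` of part I) — so a later named definition, or the tree's
  `WeierstrassCurve.padicLimitLog` over `ℚ_p`, is matched with `ℓ` at the cost of that estimate;
* `limitLog_map` — **Galois equivariance** `ℓ(σQ) = σ(ℓQ)` for an isometric `E`-algebra
  endomorphism `σ` of `L ⊇ E` acting on the points of `X_L` by `Affine.Point.map σ` (the setting
  of `UnramifiedFormalGroupH1Proofs`: one universe for `E`, `L`), and `limitLog_sum_map_pow` — the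
  **norm-to-trace formula** `ℓ(Σ_{j<n} σʲQ) = Σ_{j<n} σʲ(ℓQ)` (for a cyclic unramified layer with
  group `⟨σ⟩` of order `n`: `ℓ ∘ N = Tr ∘ ℓ`);
* `level_val_natCast_eq_kernel` — under the **unramified normalisation** `|x| < 1 ⇒ |x| ≤ |p|`
  the level `E⁽ᵖ⁾` is all of `E₁`, so everything applies to every point of the kernel of
  reduction and reads `log(E₁(K)) ⊆ p𝒪_K` etc.;
* `exists_limitLog_of_completeSpace` — for a **complete nonarchimedean normed field**
  (`[NontriviallyNormedField K] [IsUltrametricDist K] [CompleteSpace K]`,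
  `w = NormedField.valuation = ‖·‖₊`) the completeness hypothesis `hcomplete` is a (private)
  lemma (geometric Cauchy criterion, ultrametric telescoping, closed balls), whence the existence
  of `ℓ` with (SPEC) outright.

Motivation: the E-side input (E-K1) of the `bsd-addord` SAT₀ argument for the crux
`KatoKuriharaPortThreeShared` (log_ω on `E₁(K_w)` over the unramified completions `K_w`:
integral, additive, Galois-equivariant, norm ↦ trace); see part I.

## Sources

* [SilvermanAEC2009] J. H. Silverman, *The Arithmetic of Elliptic Curves*, 2nd ed. (2009),
  IV.2–IV.6 (formal group, `[m]`, the formal logarithm, Thm. IV.6.4), Prop. VII.2.2. [folklore]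
  for the limit route and the elementary analysis.

## Design

No definitions; the (SPEC) hypothesis `hℓ` is spelled out in every statement; section
`Equivariance` uses one universe `u` for `E` and `L` (as the layer files do, so that
`zCoord_map` / `map_mem_kernel_iff` apply verbatim).  `noncomputable section`,
`open scoped Classical NNReal`; axioms standard.
-/

noncomputable section

open scoped Classical NNReal

namespace Literature.NumberTheory.EllipticCurves.FormalGroupChart

/-! ### `ℓ` is a homomorphism on `E⁽ᵖ⁾`; kernel; characterisation -/

section Spec

variable {K : Type*} [Field K] {w : Valuation K ℝ≥0} {V : WeierstrassCurve K}
  [hV : V.IsIntegral w.integer] {p : ℕ} {ℓ : V.toAffine.Point → K}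

/-- `ℓ(O) = 0` (the logarithm is a homomorphism). [cite: SilvermanAEC2009, Thm. IV.6.4(a)] -/
theorem limitLog_zero (hp0 : (p : K) ≠ 0) (hp1 : w (p : K) < 1)
    (hℓ : ∀ Q ∈ level w V (w (p : K)), ∀ r : ℕ,
      w (ℓ Q - ((p ^ r) • Q).zCoord / (p : K) ^ r) ≤ w (p : K) ^ (r + 1)) : ℓ 0 = 0 := by
  have h0 : (0 : V.toAffine.Point) ∈ level w V (w (p : K)) := (level w V (w (p : K))).zero_mem
  have h := limitLog_add hp0 hp1 hℓ h0 h0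
  rw [add_zero] at h
  -- `ℓ 0 = ℓ 0 + ℓ 0`
  have : ℓ 0 + ℓ 0 = ℓ 0 + 0 := by rw [add_zero]; exact h.symm
  exact add_left_cancel this

/-- `ℓ(−P) = −ℓ(P)` on `E⁽ᵖ⁾` (the logarithm is a homomorphism). [cite: SilvermanAEC2009, Thm. IV.6.4(a)] -/
theorem limitLog_neg (hp0 : (p : K) ≠ 0) (hp1 : w (p : K) < 1)
    (hℓ : ∀ Q ∈ level w V (w (p : K)), ∀ r : ℕ,
      w (ℓ Q - ((p ^ r) • Q).zCoord / (p : K) ^ r) ≤ w (p : K) ^ (r + 1))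
    {P : V.toAffine.Point} (hP : P ∈ level w V (w (p : K))) : ℓ (-P) = -ℓ P := by
  have h := limitLog_add hp0 hp1 hℓ hP ((level w V (w (p : K))).neg_mem hP)
  rw [add_neg_cancel, limitLog_zero hp0 hp1 hℓ] at h
  exact (neg_eq_of_add_eq_zero_right h.symm).symm

/-- `ℓ(P − Q) = ℓ(P) − ℓ(Q)` on `E⁽ᵖ⁾` (the logarithm is a homomorphism).
[cite: SilvermanAEC2009, Thm. IV.6.4(a)] -/
theorem limitLog_sub (hp0 : (p : K) ≠ 0) (hp1 : w (p : K) < 1)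
    (hℓ : ∀ Q ∈ level w V (w (p : K)), ∀ r : ℕ,
      w (ℓ Q - ((p ^ r) • Q).zCoord / (p : K) ^ r) ≤ w (p : K) ^ (r + 1))
    {P Q : V.toAffine.Point} (hP : P ∈ level w V (w (p : K)))
    (hQ : Q ∈ level w V (w (p : K))) : ℓ (P - Q) = ℓ P - ℓ Q := by
  rw [sub_eq_add_neg, limitLog_add hp0 hp1 hℓ hP ((level w V (w (p : K))).neg_mem hQ),
    limitLog_neg hp0 hp1 hℓ hQ, sub_eq_add_neg]

/-- **Finite sums: `ℓ(Σᵢ Pᵢ) = Σᵢ ℓ(Pᵢ)`** for points of `E⁽ᵖ⁾` (the logarithm is a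
homomorphism). [cite: SilvermanAEC2009, Thm. IV.6.4(a)] -/
theorem limitLog_sum (hp0 : (p : K) ≠ 0) (hp1 : w (p : K) < 1)
    (hℓ : ∀ Q ∈ level w V (w (p : K)), ∀ r : ℕ,
      w (ℓ Q - ((p ^ r) • Q).zCoord / (p : K) ^ r) ≤ w (p : K) ^ (r + 1))
    {ι : Type*} (s : Finset ι) (P : ι → V.toAffine.Point)
    (hP : ∀ i ∈ s, P i ∈ level w V (w (p : K))) :
    ℓ (∑ i ∈ s, P i) = ∑ i ∈ s, ℓ (P i) := by
  classical
  induction s using Finset.induction_on with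
  | empty => rw [Finset.sum_empty, Finset.sum_empty, limitLog_zero hp0 hp1 hℓ]
  | insert a s ha ih =>
    have hPa : P a ∈ level w V (w (p : K)) := hP a (Finset.mem_insert_self a s)
    have hPs : ∀ i ∈ s, P i ∈ level w V (w (p : K)) :=
      fun i hi ↦ hP i (Finset.mem_insert_of_mem hi)
    rw [Finset.sum_insert ha, Finset.sum_insert ha,
      limitLog_add hp0 hp1 hℓ hPa ((level w V (w (p : K))).sum_mem hPs), ih hPs]

/-- `ℓ(n·P) = n·ℓ(P)` on `E⁽ᵖ⁾` (the logarithm is a homomorphism).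
[cite: SilvermanAEC2009, Thm. IV.6.4(a)] -/
theorem limitLog_nsmul (hp0 : (p : K) ≠ 0) (hp1 : w (p : K) < 1)
    (hℓ : ∀ Q ∈ level w V (w (p : K)), ∀ r : ℕ,
      w (ℓ Q - ((p ^ r) • Q).zCoord / (p : K) ^ r) ≤ w (p : K) ^ (r + 1))
    {P : V.toAffine.Point} (hP : P ∈ level w V (w (p : K))) (n : ℕ) :
    ℓ (n • P) = n * ℓ P := by
  have h := limitLog_sum hp0 hp1 hℓ (Finset.range n) (fun _ ↦ P) (fun _ _ ↦ hP)
  simp only [Finset.sum_const, Finset.card_range, nsmul_eq_mul] at h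
  exact h

/-- **`ℓ(Q) = 0` only for `Q = O` strictly inside the level** (`|z(Q)| < |p|`): the logarithm
has no kernel there (Silverman, *AEC* IV.6.4: `log` is injective on `Ê(𝓜ʳ)`, `r > v(p)/(p−1)`).
[cite: SilvermanAEC2009, Thm. IV.6.4] -/
theorem eq_zero_of_limitLog_eq_zero (hp0 : (p : K) ≠ 0) (hp1 : w (p : K) < 1)
    (hℓ : ∀ Q ∈ level w V (w (p : K)), ∀ r : ℕ,
      w (ℓ Q - ((p ^ r) • Q).zCoord / (p : K) ^ r) ≤ w (p : K) ^ (r + 1))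
    {Q : V.toAffine.Point} (hQ : Q ∈ level w V (w (p : K))) (hlt : w Q.zCoord < w (p : K))
    (h0 : ℓ Q = 0) : Q = 0 := by
  have h := val_limitLog_eq_of_val_lt hp0 hp1 hℓ hQ hlt
  rw [h0, map_zero] at h
  exact (zCoord_eq_zero_iff hQ.1).mp ((Valuation.zero_iff w).mp h.symm)

/-- **Characterisation**: a function `ℓ′` which is ADDITIVE on `E⁽ᵖ⁾` and satisfies only the
quadratic estimate `|ℓ′(Q) − z(Q)| ≤ |z(Q)|²/|p|` there automatically satisfies (SPEC) — hence
(by `limitLog_unique`) coincides on `E⁽ᵖ⁾` with any limit logarithm.  (This is how a later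
named definition, or the tree's `WeierstrassCurve.padicLimitLog` over `ℚ_p`, is matched with the
`ℓ` of `exists_limitLog`.) [cite: SilvermanAEC2009, Thm. IV.6.4] -/
theorem spec_of_additive_of_val_sub_zCoord_le (hp0 : (p : K) ≠ 0)
    {ℓ' : V.toAffine.Point → K}
    (hadd : ∀ P Q : V.toAffine.Point, P ∈ level w V (w (p : K)) →
      Q ∈ level w V (w (p : K)) → ℓ' (P + Q) = ℓ' P + ℓ' Q)
    (hest : ∀ Q ∈ level w V (w (p : K)), w (ℓ' Q - Q.zCoord) ≤ w Q.zCoord ^ 2 / w (p : K)) :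
    ∀ Q ∈ level w V (w (p : K)), ∀ r : ℕ,
      w (ℓ' Q - ((p ^ r) • Q).zCoord / (p : K) ^ r) ≤ w (p : K) ^ (r + 1) := by
  have hp : 0 < w (p : K) := (Valuation.pos_iff w).mpr hp0
  have hp1 : w (p : K) ≤ 1 := val_natCast_le_one w p
  -- `ℓ'` is `ℕ`-linear on the level
  have hzero : ℓ' 0 = 0 := by
    have h := hadd 0 0 (level w V (w (p : K))).zero_mem (level w V (w (p : K))).zero_mem
    rw [add_zero] at h
    have : ℓ' 0 + ℓ' 0 = ℓ' 0 + 0 := by rw [add_zero]; exact h.symm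
    exact add_left_cancel this
  have hnsmul : ∀ Q ∈ level w V (w (p : K)), ∀ n : ℕ, ℓ' (n • Q) = n * ℓ' Q := by
    intro Q hQ n
    induction n with
    | zero => rw [zero_nsmul, hzero, Nat.cast_zero, zero_mul]
    | succ n ih =>
      rw [succ_nsmul, hadd _ _ ((level w V (w (p : K))).nsmul_mem hQ _) hQ, ih, Nat.cast_succ]
      ring
  intro Q hQ r
  have hR : (p ^ r) • Q ∈ level w V (w (p : K)) := (level w V (w (p : K))).nsmul_mem hQ _
  have hRz : w ((p ^ r) • Q).zCoord ≤ w (p : K) ^ r * w Q.zCoord :=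
    val_zCoord_pow_smul_le hQ.1 hQ.2 r
  have hpr : (p : K) ^ r ≠ 0 := pow_ne_zero _ hp0
  have e : ℓ' Q - ((p ^ r) • Q).zCoord / (p : K) ^ r =
      (ℓ' ((p ^ r) • Q) - ((p ^ r) • Q).zCoord) / (p : K) ^ r := by
    rw [hnsmul Q hQ (p ^ r), Nat.cast_pow]
    field_simp
  rw [e, map_div₀, map_pow, div_le_iff₀ (pow_pos hp _)]
  refine (hest _ hR).trans ?_
  rw [div_le_iff₀ hp]
  calc w ((p ^ r) • Q).zCoord ^ 2 ≤ (w (p : K) ^ r * w Q.zCoord) ^ 2 := by gcongr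
    _ ≤ (w (p : K) ^ r * w (p : K)) ^ 2 := by gcongr; exact hQ.2
    _ = w (p : K) ^ (r + 1) * w (p : K) ^ r * w (p : K) := by ring

end Spec

/-! ### Galois equivariance and the norm-to-trace formula -/

section Equivariance

universe u

variable {E : Type u} [Field E] {L : Type u} [Field L] [Algebra E L] {X : WeierstrassCurve E}
  {w : Valuation L ℝ≥0} [hV : (X.baseChange L).IsIntegral w.integer] {p : ℕ}
  {ℓ : (X.baseChange L).toAffine.Point → L}

/-- An isometric `E`-algebra endomorphism preserves the level `E⁽ᵖ⁾`. [folklore] -/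
private theorem map_mem_level {σ : L →ₐ[E] L} (hσ : ∀ x, w (σ x) = w x)
    {Q : (X.baseChange L).toAffine.Point} (hQ : Q ∈ level w (X.baseChange L) (w (p : L))) :
    WeierstrassCurve.Affine.Point.map σ Q ∈ level w (X.baseChange L) (w (p : L)) :=
  ⟨(map_mem_kernel_iff hσ Q).mpr hQ.1, by rw [zCoord_map, hσ]; exact hQ.2⟩

/-- **Galois equivariance: `ℓ(σQ) = σ(ℓQ)`** for an isometric `E`-algebra endomorphism `σ` of
`L` and `Q ∈ E⁽ᵖ⁾(X_L)` (both sides satisfy (SPEC) for `σQ`: `z` and `[pʳ]` commute with `σ`,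
`σ` fixes `p` and is an isometry). [cite: SilvermanAEC2009, IV.5–IV.6 with Prop. VII.2.2] -/
theorem limitLog_map (hp1 : w (p : L) < 1)
    (hℓ : ∀ Q ∈ level w (X.baseChange L) (w (p : L)), ∀ r : ℕ,
      w (ℓ Q - ((p ^ r) • Q).zCoord / (p : L) ^ r) ≤ w (p : L) ^ (r + 1))
    {σ : L →ₐ[E] L} (hσ : ∀ x, w (σ x) = w x)
    {Q : (X.baseChange L).toAffine.Point} (hQ : Q ∈ level w (X.baseChange L) (w (p : L))) :
    ℓ (WeierstrassCurve.Affine.Point.map σ Q) = σ (ℓ Q) := by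
  refine limitLog_eq_of_forall_val_sub_approx_le hp1 hℓ (map_mem_level hσ hQ) fun r ↦ ?_
  have e : σ (ℓ Q) - ((p ^ r) • WeierstrassCurve.Affine.Point.map σ Q).zCoord / (p : L) ^ r =
      σ (ℓ Q - ((p ^ r) • Q).zCoord / (p : L) ^ r) := by
    rw [← map_nsmul, zCoord_map, map_sub, map_div₀, map_pow, map_natCast]
  rw [e, hσ]
  exact hℓ Q hQ r

/-- Powers of an isometry are isometries. [folklore] -/
private theorem val_map_pow_eq {σ : L →ₐ[E] L} (hσ : ∀ x, w (σ x) = w x) (j : ℕ) (x : L) :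
    w ((σ ^ j) x) = w x := by
  induction j generalizing x with
  | zero => rfl
  | succ j ih => rw [pow_succ, AlgHom.mul_apply, ih, hσ]

/-- **Norm-to-trace formula: `ℓ(Σ_{j<n} σʲ Q) = Σ_{j<n} σʲ(ℓ Q)`** for an isometric `σ` and
`Q ∈ E⁽ᵖ⁾` — for a cyclic layer `K_n/K` with group `⟨σ⟩` of order `n` this is
`ℓ(N_{K_n/K} Q) = Tr_{K_n/K}(ℓ Q)` (additivity + equivariance). [cite: SilvermanAEC2009, IV.5–IV.6 with Prop. VII.2.2] -/
theorem limitLog_sum_map_pow (hp0 : (p : L) ≠ 0) (hp1 : w (p : L) < 1)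
    (hℓ : ∀ Q ∈ level w (X.baseChange L) (w (p : L)), ∀ r : ℕ,
      w (ℓ Q - ((p ^ r) • Q).zCoord / (p : L) ^ r) ≤ w (p : L) ^ (r + 1))
    {σ : L →ₐ[E] L} (hσ : ∀ x, w (σ x) = w x) (n : ℕ)
    {Q : (X.baseChange L).toAffine.Point} (hQ : Q ∈ level w (X.baseChange L) (w (p : L))) :
    ℓ (∑ j ∈ Finset.range n, WeierstrassCurve.Affine.Point.map (σ ^ j) Q) =
      ∑ j ∈ Finset.range n, (σ ^ j) (ℓ Q) := by
  rw [limitLog_sum hp0 hp1 hℓ (Finset.range n) _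
    (fun j _ ↦ map_mem_level (val_map_pow_eq hσ j) hQ)]
  exact Finset.sum_congr rfl fun j _ ↦ limitLog_map hp1 hℓ (val_map_pow_eq hσ j) hQ

end Equivariance

/-! ### The unramified normalisation, and complete normed fields -/

section Unramified

variable {K : Type*} [Field K] {w : Valuation K ℝ≥0} {V : WeierstrassCurve K}
  [hV : V.IsIntegral w.integer]

/-- **Under the unramified normalisation `|x| < 1 ⇒ |x| ≤ |p|` the level `E⁽ᵖ⁾` is the whole
kernel of reduction `E₁`** (`|z| < 1` on `E₁`), so all of the above applies to every point of
`E₁`. [cite: SilvermanAEC2009, Thm. IV.6.4(b)] -/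
theorem level_val_natCast_eq_kernel {p : ℕ} (hdisc : ∀ x : K, w x < 1 → w x ≤ w (p : K)) :
    level w V (w (p : K)) = kernel w V :=
  le_antisymm (level_le_kernel _) fun _ hP ↦ ⟨hP, hdisc _ (val_zCoord_lt_one hP)⟩

end Unramified

section Normed

variable {K : Type*} [NontriviallyNormedField K] [IsUltrametricDist K] [CompleteSpace K]

/-- **Completeness in the shape `hcomplete`**: in a complete nonarchimedean normed field every
sequence with `|x_{r+1} − x_r| ≤ ρ^{r+1}` (`ρ < 1`) has a limit `y` with `|y − x_r| ≤ ρ^{r+1}`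
for all `r` (geometric Cauchy criterion + ultrametric telescoping + closedness of balls).
[folklore] -/
private theorem exists_forall_val_sub_le_pow_of_completeSpace {ρ : ℝ≥0} (hρ1 : ρ < 1) (x : ℕ → K)
    (hx : ∀ r, NormedField.valuation (x (r + 1) - x r) ≤ ρ ^ (r + 1)) :
    ∃ y : K, ∀ r, NormedField.valuation (y - x r) ≤ ρ ^ (r + 1) := by
  have hx' : ∀ r, ‖x (r + 1) - x r‖ ≤ (ρ : ℝ) ^ (r + 1) := fun r ↦ by
    have h := hx r
    rw [NormedField.valuation_apply, ← NNReal.coe_le_coe, coe_nnnorm, NNReal.coe_pow] at h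
    exact h
  have hu : ∀ n, dist (x n) (x (n + 1)) ≤ (ρ : ℝ) * (ρ : ℝ) ^ n := fun n ↦ by
    rw [dist_comm, dist_eq_norm, ← pow_succ']
    exact hx' n
  have hρ1' : (ρ : ℝ) < 1 := by exact_mod_cast hρ1
  have hcau : CauchySeq x := cauchySeq_of_le_geometric (ρ : ℝ) (ρ : ℝ) hρ1' hu
  obtain ⟨y, hy⟩ := cauchySeq_tendsto_of_complete hcau
  refine ⟨y, fun r ↦ ?_⟩
  -- `‖x s - x r‖ ≤ ρ^{r+1}` for all `s ≥ r`, by ultrametric telescoping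
  have htel : ∀ k, ‖x (k + r) - x r‖ ≤ (ρ : ℝ) ^ (r + 1) := by
    intro k
    induction k with
    | zero => simp only [zero_add, sub_self, norm_zero]; positivity
    | succ k ih =>
      have h1 : ‖x (k + r + 1) - x (k + r)‖ ≤ (ρ : ℝ) ^ (r + 1) :=
        (hx' (k + r)).trans (pow_le_pow_of_le_one (NNReal.coe_nonneg ρ) hρ1'.le (by omega))
      have ek : k + 1 + r = k + r + 1 := by omega
      calc ‖x (k + 1 + r) - x r‖ = dist (x (k + r + 1)) (x r) := by rw [dist_eq_norm, ek]
        _ ≤ max (dist (x (k + r + 1)) (x (k + r))) (dist (x (k + r)) (x r)) :=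
            dist_triangle_max _ _ _
        _ ≤ (ρ : ℝ) ^ (r + 1) := by
            rw [dist_eq_norm, dist_eq_norm]; exact max_le h1 ih
  have hlim : Filter.Tendsto (fun k ↦ ‖x (k + r) - x r‖) Filter.atTop
      (nhds ‖y - x r‖) :=
    (((Filter.tendsto_add_atTop_iff_nat r).mpr hy).sub_const (x r)).norm
  have hle : ‖y - x r‖ ≤ (ρ : ℝ) ^ (r + 1) :=
    le_of_tendsto' hlim fun k ↦ htel k
  rw [NormedField.valuation_apply, ← NNReal.coe_le_coe, coe_nnnorm, NNReal.coe_pow]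
  exact hle

variable {V : WeierstrassCurve K} [hV : V.IsIntegral (NormedField.valuation (K := K)).integer]

/-- **Existence of a limit logarithm on `E⁽ᵖ⁾` over a complete nonarchimedean normed field**
(`w = NormedField.valuation = ‖·‖₊`): a function `ℓ` with (SPEC)
`‖ℓ(Q) − z(pʳ·Q)/pʳ‖ ≤ ‖p‖^{r+1}` for every `Q ∈ E⁽ᵖ⁾` and `r`, for any natural number `p`
with `0 < ‖p‖ < 1` in `K`; all properties of section `Spec`/`Equivariance` apply to it.
[cite: SilvermanAEC2009, IV.5–IV.6 (the formal logarithm) with Prop. VII.2.2] -/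
theorem exists_limitLog_of_completeSpace {p : ℕ} (hp0 : (p : K) ≠ 0)
    (hp1 : NormedField.valuation (p : K) < 1) :
    ∃ ℓ : V.toAffine.Point → K, ∀ Q ∈ level NormedField.valuation V
      (NormedField.valuation (p : K)), ∀ r : ℕ,
      NormedField.valuation (ℓ Q - ((p ^ r) • Q).zCoord / (p : K) ^ r) ≤
        NormedField.valuation (p : K) ^ (r + 1) :=
  exists_limitLog hp0 fun x hx ↦ exists_forall_val_sub_le_pow_of_completeSpace hp1 x hx

end Normed

end Literature.NumberTheory.EllipticCurves.FormalGroupChart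

end
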